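import Mathlib
import Summits.Ventures.FusionMHD.Models.CerfonFreidbergIterLikeQHalfShearDefs
import HarnessLib

/-!
# Ventures/FusionMHD — Models/CerfonFreidbergIterLikeQHalfShearPanels3.lean: KERNEL CHECK of the shear-register certificates of panels 4, 5 (of 32)
# at `ψ_N = 1/2` of THE Cerfon–Freidberg ITER-like instance

HONEST FRAMING (LADDER-GRIDFUSION three columns; CF rung; successor step of «q′(ψ_N = 1/2) on the CF rung», F2-SCOPING v1.6 §10(c)).  One `decide +kernel`
(≈ 80 s): for each listed panel the obligation `CFIterLike.QHalfShear.ShearCert.ok` (`Models/CerfonFreidbergIterLikeQHalfShearDefs.lean`) — the Taylor-model run of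
`progQ = CFIterLike.QHalf.progA ++ blockQ` over ★ #117's parameter box is ACCEPTED and the kernel's panel-integral enclosure of the shear kernel `K·p` along the
approximant lies inside the claimed integers (read off a compiled `#eval` of the same functions, slack one unit of `2⁻⁶⁰`; float truth inside every panel).
MODELLED: analytic Cerfon–Freidberg family; nothing about a device or stability.  No `native_decide`.  Typer/prover: gridfusion-model-5 (g8), 2026-08-27.
Citations: Freidberg 2014 §6.3.5 (6.35) [Freidberg2014]; Mahboubi–Melquiond–Sibut-Pinote 2016 §3.2 Lemma 3 [MahboubiMelquiondSibutpinote2016].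
-/

namespace Summit.Ventures.FusionMHD.Models.CFIterLike.QHalfShear

/-- Shear-register certificate data of panels 4, 5. [instance data] -/
def shearCert3 : List ShearCert := [
  { j := 4, cand := [108480286632410759168, 216509018897923964928, 1041217257826832351232, 2223391253096127791104, 6842061410766530019328, 15362200586546336235520, 38845600046945149124608, 83987875500792483938304, -5278130751031964860416, -1862680438595158768877568, 619759244057556586642538496, 3281798601207860352312672256, -778778086325556381674335371264],
    deg := 10, elog2 := 42, plo := -1016477639628601113, phi := -1016477522363069258 },
  { j := 5, cand := [116337881404870803456, 289014935329021001728, 1295051234626762178560, 3255481473900758433792, 9913724120429540409344, 24709392550004873232384, 63059987032626077630464, 143076421757474382544896, 501194581417686854533120, 5649330979295429549621248, -727376638559330436888133632, -8590340253233749676324290560, 1059309487091443221872852860928],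
    deg := 10, elog2 := 42, plo := -1084581801258535865, phi := -1084581681703221948 }]

/-- **KERNEL CHECK** of the shear register on panels 4, 5. -/
theorem shearCert3_ok : CFIterLike.QHalfShear.shearCert3.all ShearCert.ok = true := by
  decide +kernel

end Summit.Ventures.FusionMHD.Models.CFIterLike.QHalfShear
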